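import Literature.IUT.LogThetaLattice.DistinctCollectionsOfKitsTagged
import Literature.IUT.LogThetaLattice.ThetaGauChainOfKitsRlfTagged
import HarnessLib

/-!
# [IUTchIII] Def 1.4 ∧ Prop 1.2 (x) ∧ [IUTchII] Cor 4.10 (vi): ALL THREE «distinct collection» interfaces INHABITED at ONE
# `StripFrame.ofKits` instance, FOR EVERY KIT DATUM (bi-tagging: `ℱ`-side and `ℱ^⊩`-side)

Mochizuki, *Inter-universal Teichmüller Theory III*, kurims manuscript (May 2020), Def 1.1 p. 23, Prop 1.2 (x) p. 34, Def 1.4 p. 45;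
*II* (Dec 2020) Cor 4.10 (i)–(vi) pp. 158–161; *I* (May 2020) Def 5.2 pp. 134–135, Def 6.11 (iii) p. 173. abc-iut cell, seat abc-iut-w5-d043
(L6 NV row «NV-W2 IUTchIII:Def1.4», part W2d = composition of W2c `DistinctCollectionsOfKitsTagged.lean` (`FKit.tagF`: Def 1.4 + Prop 1.2 (x)
for every kit datum) with W2b `ThetaGauChainOfKitsRlfTagged.lean` (`FKit.tagRlf`: Cor 4.10 (vi) for every kit datum)). PROOF-SIDE glue only:
the two remaining transfers along the `ℱ^⊩`-tagging — `ThetaLinkKit.tagRlf` (pilots through `HTRep.untagRlf`, the identity-on-data functor of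
abc-iut-L6-t3's representative groupoids) and `LogKit.tagRlf` (verbatim: the `ℱ`-side is untouched) — and the injective theater family
read over the bi-tagged kit; then **`distinctCollections_ofKits_biTag`**: for EVERY kit datum `(FK, L, hbij, hsurj, hR, X, TK, LK)`, every
`Θ^{±ell}`-Hodge theater `H₀ : FK.ThetaPMEllHT` and every place `v₀`, at the frame assembled from `(FK.tagF Tag tag₀).tagRlf Tag tag₀`
(`Tag = ULift (ℤ × ℤ)`) a log-theta-lattice of DISTINCT theaters (Def 1.4), a Frobenius-picture chain of DISTINCT `ℱ`-prime-strips
(Prop 1.2 (x)) and a chain of DISTINCT theaters through their `ℱ^⊩`-prime-strips (Cor 4.10 (vi)) ALL EXIST. HONEST LABEL (abc-iut-L6-lead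
§F v1.19j (1)): relabelled copies of ONE theater; bookkeeping about the typed kit signature with a non-vacuity consequence, NOT genuine
Hodge theaters; nothing here bears on the real-kit line (abc-iut-L5-t4). No Prop fact, no instance. Consistency ≠ endorsement; typed ≠
proved; no side taken on [IUTchIII] Cor 3.12. [claim: Mochizuki2012, status: disputed]
-/

noncomputable section

namespace Literature.IUT.LogThetaLattice

open CategoryTheory
open Literature.IUT.HodgeArakelov Literature.IUT.HodgeTheaters Literature.IUT.HodgeTheaters.PMBaseKit

universe u

section Generic

variable {l : ℕ} {K : PMBaseKit.{u} l} {M : K.MultKit} {FK : K.FKit M} {L : FK.MonoLaws} (ι : Type u) (i₀ : ι)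

/-- **IUTchI:Def6.11(iii)** (kurims p.173) A theater over the `ℱ^⊩`-tagged kit read over `FK` (the `ℱ`-side is untouched: same data,
re-typed). [claim: Mochizuki2012, status: disputed] -/
def FKit.ThetaPMEllHT.untagRlf (H : (FK.tagRlf ι i₀).ThetaPMEllHT) : FK.ThetaPMEllHT where
  T := H.T
  fintypeT := H.fintypeT
  grpT := H.grpT
  capsule t := FKit.FStrip.untagRlf ι i₀ (H.capsule t)
  codomain := FKit.FStrip.untagRlf ι i₀ H.codomain
  glob := H.glob
  dPolyPM := H.dPolyPM
  dPolyEll := H.dPolyEll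
  exists_model := H.exists_model

/-- **IUTchI:Def6.11(iii)** (kurims p.173) A theater over `FK` read over the `ℱ^⊩`-tagged kit (same data, re-typed). [claim: Mochizuki2012, status: disputed] -/
def FKit.ThetaPMEllHT.retagRlf (H : FK.ThetaPMEllHT) : (FK.tagRlf ι i₀).ThetaPMEllHT where
  T := H.T
  fintypeT := H.fintypeT
  grpT := H.grpT
  capsule t := ⟨(H.capsule t).obj, (H.capsule t).isModel⟩
  codomain := ⟨H.codomain.obj, H.codomain.isModel⟩
  glob := H.glob
  dPolyPM := H.dPolyPM
  dPolyEll := H.dPolyEll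
  exists_model := H.exists_model

/-- **IUTchI:Def6.11(iii)** (kurims p.173) Re-typing is injective (the data are the same). [claim: Mochizuki2012, status: disputed] -/
theorem FKit.ThetaPMEllHT.retagRlf_injective : Function.Injective (FKit.ThetaPMEllHT.retagRlf ι i₀ (FK := FK)) := by
  intro H H' h
  have h' := congrArg (FKit.ThetaPMEllHT.untagRlf ι i₀) h
  exact h'

/-- **IUTchI:Def6.11(iii)** (kurims p.173) Forgetting the (absent) `ℱ^⊩`-tag on representatives: the identity-on-data functor of
abc-iut-L6-t3's representative-level Hodge-theater groupoids. [claim: Mochizuki2012, status: disputed] -/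
def HTRep.untagRlf : HTRep (FK.tagRlf ι i₀) ⥤ HTRep FK where
  obj X := HTRep.of (FKit.ThetaPMEllHT.untagRlf ι i₀ X.out)
  map f := { toD := f.toD, caps := f.caps, cod := f.cod, caps_lifts := f.caps_lifts, cod_lifts := f.cod_lifts }
  map_id _ := rfl
  map_comp _ _ := rfl

variable {ι i₀}

/-- **IUTchII:Cor4.10(i)** (kurims p.158) The Cor 4.10 (i)–(iv) kit datum transfers along the `ℱ^⊩`-tagging: pilots through `HTRep.untagRlf`
(the `F^{⊩▶×μ}`-category of `TimesMuSide.tagRlf` is the original one). [claim: Mochizuki2012, status: disputed] -/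
def ThetaLinkKit.tagRlf {X : TimesMuSide FK L} (TK : ThetaLinkKit X) : ThetaLinkKit (X.tagRlf ι i₀) where
  pilotDelta := HTRep.untagRlf ι i₀ ⋙ TK.pilotDelta
  pilotTheta k := HTRep.untagRlf ι i₀ ⋙ TK.pilotTheta k
  unitPortion k := Functor.isoWhiskerLeft (HTRep.untagRlf ι i₀) (TK.unitPortion k)
  induced_full k H H' := TK.induced_full k ((HTRep.untagRlf ι i₀).obj H) ((HTRep.untagRlf ι i₀).obj H')

variable (ι i₀)

/-- **IUTchIII:Def1.1(i)** (kurims p.24) The Def 1.1 (i) kit datum transfers VERBATIM along the `ℱ^⊩`-tagging. [claim: Mochizuki2012, status: disputed] -/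
def LogKit.tagRlf (LK : LogKit FK) : LogKit (FK.tagRlf ι i₀) where
  log := LK.log
  log_model := LK.log_model
  logD := LK.logD

/-! ### The bi-tagged kit datum and the three collections -/

variable (L) (hbij : FK.IsomFtoDBijective) (hsurj : FK.IsomFmtoDmSurjective) (hR : FK.RlfOfIsStrip) (X : TimesMuSide FK L)

/-- **IUTchI:Def5.2(i)** (kurims p.134) The BI-TAGGED kit: `ℱ`-side tagged (W2c), then `ℱ^⊩`-side tagged (W2b), tags `Tag = ULift (ℤ × ℤ)`.
[claim: Mochizuki2012, status: disputed] -/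
abbrev FKit.biTag (FK : K.FKit M) : K.FKit M := (FK.tagF Tag.{u} tag₀).tagRlf Tag.{u} tag₀

/-- **IUTchIII:Def1.1** (kurims p.23) The frame assembled from the bi-tagged kit datum. [claim: Mochizuki2012, status: disputed] -/
abbrev StripFrame.ofKitsBiTag : StripFrame.{max 1 u} :=
  StripFrame.ofKitsTagRlf (L.tagF Tag.{u} tag₀) Tag.{u} tag₀ (FKit.isomFtoDBijective_tagF Tag.{u} tag₀ hbij)
    (FKit.isomFmtoDmSurjective_tagF Tag.{u} tag₀ hsurj) (FKit.rlfOfIsStrip_tagF Tag.{u} tag₀ hR) (X.tagF Tag.{u} tag₀)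

/-- **IUTchIII:Def1.1(iii)** (kurims p.26) The §1 log-strip interface over the bi-tagged frame. [claim: Mochizuki2012, status: disputed] -/
abbrev logStripDataBiTag (LK : LogKit FK) : LogStripData (StripFrame.ofKitsBiTag L hbij hsurj hR X) :=
  LogStripData.ofKits _ _ _ _ _ ((LK.tagF Tag.{u} tag₀).tagRlf Tag.{u} tag₀)

/-- **IUTchII:Cor4.10(iii)** (kurims p.160) The §1 horizontal-arrow interface over the bi-tagged frame. [claim: Mochizuki2012, status: disputed] -/
abbrev thetaLinkDataBiTag (TK : ThetaLinkKit X) : ThetaLinkData (StripFrame.ofKitsBiTag L hbij hsurj hR X) :=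
  ThetaLinkData.ofKits _ _ _ _ _
    (ThetaLinkKit.tagRlf (ι := Tag.{u}) (i₀ := tag₀) (ThetaLinkKit.tagF (ι := Tag.{u}) (i₀ := tag₀) TK))

/-- **IUTchIII:Def1.4** (kurims p.45) The family `(n, m) ↦ H₀` re-tagged `(n, m)`, over the bi-tagged kit. [claim: Mochizuki2012, status: disputed] -/
abbrev theaterFamilyBiTag (H₀ : FK.ThetaPMEllHT) (p : ℤ × ℤ) : (FKit.biTag FK).ThetaPMEllHT :=
  FKit.ThetaPMEllHT.retagRlf Tag.{u} tag₀ (theaterFamily H₀ p)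

/-- **IUTchIII:Def1.4** (kurims p.45) "Distinct": injective at any kit with a place. [claim: Mochizuki2012, status: disputed] -/
theorem theaterFamilyBiTag_injective (v₀ : K.V) (H₀ : FK.ThetaPMEllHT) :
    Function.Injective (theaterFamilyBiTag (FK := FK) H₀) :=
  (FKit.ThetaPMEllHT.retagRlf_injective Tag.{u} tag₀).comp (theaterFamily_injective v₀ H₀)

/-- **IUTchIII:Def1.4** (kurims p.45) [IUTchIII] Def 1.4 over the bi-tagged kit, for every kit datum (abc-iut-L6-t3's
`LogThetaLatticeDiagram.ofKits` on the twice-transferred data). [claim: Mochizuki2012, status: disputed] -/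
def latticeDiagramBiTag (TK : ThetaLinkKit X) (LK : LogKit FK) (kind : LatticeKind) (v₀ : K.V) (H₀ : FK.ThetaPMEllHT) :
    LogThetaLatticeDiagram (logStripDataBiTag L hbij hsurj hR X LK) (thetaLinkDataBiTag L hbij hsurj hR X TK) :=
  LogThetaLatticeDiagram.ofKits _ _ _ _ _ _ _ kind (theaterFamilyBiTag H₀) (theaterFamilyBiTag_injective v₀ H₀)

/-- **IUTchI:Def5.2(i)** (kurims p.134) The bi-tagged kit has infinitely many `ℱ`-prime-strips (the `ℱ`-tags, re-typed).
[claim: Mochizuki2012, status: disputed] -/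
theorem infinite_fStrip_biTag (v₀ : K.V) : Infinite (FKit.biTag FK).FStrip :=
  haveI := infinite_fStrip_tagF Tag.{u} tag₀ v₀ (FK := FK)
  Infinite.of_injective
    (fun F : (FK.tagF Tag.{u} tag₀).FStrip => (⟨F.obj, F.isModel⟩ : (FKit.biTag FK).FStrip))
    fun F G h => by
      cases F; cases G
      cases congrArg (FKit.FStrip.untagRlf Tag.{u} tag₀) h
      rfl

/-- **IUTchIII:Def1.4** (kurims p.45) **ALL THREE «distinct collection» interfaces at ONE `StripFrame.ofKits` instance, FOR EVERY KIT
DATUM** `(FK, L, hbij, hsurj, hR, X, TK, LK)` with a theater `H₀` and a place `v₀`: at the bi-tagged kit frame a log-theta-lattice of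
distinct theaters (Def 1.4), a Frobenius-picture chain of distinct `ℱ`-prime-strips (Prop 1.2 (x), abc-iut-w5-d005's criterion) and a chain
of distinct theaters through their `ℱ^⊩`-prime-strips ([IUTchII] Cor 4.10 (vi), abc-iut-w5-d193's criterion) ALL EXIST — the three clauses
constrain no kit datum. [claim: Mochizuki2012, status: disputed] -/
theorem distinctCollections_ofKits_biTag (TK : ThetaLinkKit X) (LK : LogKit FK) (kind : LatticeKind) (v₀ : K.V)
    (H₀ : FK.ThetaPMEllHT) :
    Nonempty (LogThetaLatticeDiagram (logStripDataBiTag L hbij hsurj hR X LK) (thetaLinkDataBiTag L hbij hsurj hR X TK)) ∧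
      Nonempty (FrobeniusChain (StripFrame.ofKitsBiTag L hbij hsurj hR X)) ∧
        Nonempty (ThetaGauChain (ThetaLinkSetting.ofStripFrame (StripFrame.ofKitsBiTag L hbij hsurj hR X))) :=
  ⟨⟨latticeDiagramBiTag L hbij hsurj hR X TK LK kind v₀ H₀⟩,
    (FrobeniusChain.nonempty_ofKits_iff _ _ _ _ _).2 (infinite_fStrip_biTag v₀),
    StripFrame.nonempty_thetaGauChain_ofKits_tagRlf _ Tag.{u} tag₀ _ _ _ _⟩

end Generic

end Literature.IUT.LogThetaLattice

end
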